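import Summits.AtomisticToContinuum.FouriersLaw.Theorems.OddSectorIrreversibilityWitnessGlueClosedFlow
import Literature.MathematicalPhysics.KineticTheory.ChainReflection

/-!
# `WitnessGlue` (stmt-AtomisticToContinuum-14072) — support 4: left–right reflection of the open chain

Support file for `OddSectorIrreversibility.WitnessGlue`. The tap-energy identity A(6) of
`CorrectorTheory` is stated with Bochner integrals `∫ (∂_{p_b} u)² dμ_T`, which carry the junk value
`0` when the integrand is not integrable; the glue therefore needs to know that the two tap norms
`‖∂_{p_0} u‖²`, `‖∂_{p_{N-1}} u‖²` are finite or infinite TOGETHER. This follows from the left–right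
symmetry of the open equilibrium chain:

* `chainNoise_swap`, `drift_siteReflection`, `chainFlow_siteReflection`, `solMap_siteReflection` —
  the site reflection `R : i ↦ N-1-i` maps the pathwise solution driven by the pair of paths
  `(w₁, w₂)` to the solution driven by the swapped pair (uniqueness of the integral equation);
* `transitionKernel_siteReflection` — hence, at EQUAL bath temperatures, `P_t(Rx, ·) = R_* P_t(x, ·)`
  (the product Wiener measure is swap invariant), and `P_t J (Rx) = -P_t J (x)` for the odd total
  current `J`;
* `measurePreserving_siteReflection_volume/gibbsWeight` — `R` preserves Lebesgue measure and the
  Gibbs weight;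
* `corrector_siteReflection` — an everywhere-defined continuous a.e.-limit `u` of the finite-horizon
  Kubo correctors is odd under `R` EVERYWHERE, so `∂_{p_0}u = -(∂_{p_{N-1}}u) ∘ R` and the two tap
  norms agree (`integral_partialP_sq_tap_eq`, `integrable_partialP_sq_tap_iff`).

No route statement is asserted.
-/

noncomputable section

namespace Summit.AtomisticToContinuum.FouriersLaw.Theorems.OddSectorWitness

open MeasureTheory Filter Topology ProbabilityTheory Set
open scoped NNReal ENNReal
open Literature.MathematicalPhysics.KineticTheory.HeatConduction
open Literature.Probability.Process

variable {N : ℕ}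

/-! ## Algebra of the site reflection -/

/-- The site reflection is additive. [folklore] -/
theorem siteReflection_add (x y : PhaseSpace N) :
    siteReflection N (x + y) = siteReflection N x + siteReflection N y := by
  ext i <;> rfl

/-- The site reflection of a pure momentum vector. [folklore] -/
theorem siteReflection_zero_prod (v : Fin N → ℝ) :
    siteReflection N ((0 : Fin N → ℝ), v) = ((0 : Fin N → ℝ), v ∘ Fin.rev) := by
  ext i <;> rfl

/-- `rev i = 0 ↔ i = N-1` and `rev i = N-1 ↔ i = 0` at the level of values. [folklore] -/
theorem val_rev_eq_zero_iff (i : Fin N) : (Fin.rev i).val = 0 ↔ i.val = N - 1 := by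
  have := i.isLt
  rw [Fin.val_rev]; omega

/-- See `val_rev_eq_zero_iff`. [folklore] -/
theorem val_rev_eq_last_iff (i : Fin N) : (Fin.rev i).val = N - 1 ↔ i.val = 0 := by
  have := i.isLt
  rw [Fin.val_rev]; omega

/-- The bath multiplicity is reflection symmetric. [folklore] -/
theorem bathWeight_rev (i : Fin N) : OscillatorChain.bathWeight N (Fin.rev i) = OscillatorChain.bathWeight N i := by
  unfold OscillatorChain.bathWeight
  simp only [val_rev_eq_zero_iff, val_rev_eq_last_iff]
  ring

/-- **Swapping the two driving paths reflects the noise** (equal amplitudes). [folklore] -/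
theorem chainNoise_swap (c : ℝ) (w : WienerPair) :
    chainNoise N c c (w.2, w.1) = fun t => chainNoise N c c w t ∘ Fin.rev := by
  funext t i
  simp only [chainNoise, Function.comp_apply, val_rev_eq_zero_iff, val_rev_eq_last_iff]
  ring

/-! ## Equivariance of the pathwise solution -/

section Flow

variable {ω₂ lam β γ : ℝ}

/-- The Hamiltonian of the pinned chain is reflection invariant (even interaction). [folklore] -/
theorem hamiltonian_comp_siteReflection (N : ℕ) :
    (pinnedChain ω₂ lam β γ).hamiltonian N ∘ siteReflection N = (pinnedChain ω₂ lam β γ).hamiltonian N :=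
  funext fun x => (pinnedChain ω₂ lam β γ).hamiltonian_siteReflection (pinnedChain_V_neg ω₂ lam β γ) N x

/-- **The Langevin drift is reflection equivariant**: `Y(Rz) = R Y(z)`. [folklore] -/
theorem drift_siteReflection (N : ℕ) (z : PhaseSpace N) :
    (pinnedChain ω₂ lam β γ).drift N (siteReflection N z) = siteReflection N ((pinnedChain ω₂ lam β γ).drift N z) := by
  have hQ : ∀ i : Fin N, partialQ i ((pinnedChain ω₂ lam β γ).hamiltonian N) (siteReflection N z) =
      partialQ (Fin.rev i) ((pinnedChain ω₂ lam β γ).hamiltonian N) z := by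
    intro i
    have h := partialQ_comp_siteReflection i ((pinnedChain ω₂ lam β γ).hamiltonian N) (siteReflection N z)
    rw [hamiltonian_comp_siteReflection, siteReflection_siteReflection] at h
    exact h
  unfold OscillatorChain.drift
  ext i
  · rfl
  · simp only [siteReflection_snd, hQ i, bathWeight_rev]

variable (hω : 0 < ω₂) (hl : 0 ≤ lam) (hβ : 0 ≤ β) (hγ : 0 ≤ γ)
include hω hl hβ hγ

/-- **The pathwise solution is reflection equivariant**: driving the reflected initial condition
with the reflected noise path gives the reflected solution (uniqueness of the integral equation).
[folklore] -/
theorem chainFlow_siteReflection (N : ℕ) (x : PhaseSpace N) {η : ℝ → Fin N → ℝ} (hη : Continuous η) (t : ℝ) :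
    (pinnedChain ω₂ lam β γ).chainFlow N (siteReflection N x) (fun s => η s ∘ Fin.rev) t =
      siteReflection N ((pinnedChain ω₂ lam β γ).chainFlow N x η t) := by
  set P := pinnedChain ω₂ lam β γ
  have hη' : Continuous fun s => η s ∘ Fin.rev :=
    continuous_pi fun i => (continuous_apply (Fin.rev i)).comp hη
  rcases le_or_gt t 0 with ht | ht
  · rw [pinnedChain_chainFlow_of_nonpos ω₂ lam β γ N _ hη' ht, pinnedChain_chainFlow_of_nonpos ω₂ lam β γ N _ hη ht,
      siteReflection_add, siteReflection_zero_prod]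
  -- `t > 0`: the reflected solution solves the reflected integral equation
  obtain ⟨A, hA⟩ := siteReflection_eq_continuousLinearMap (N := N)
  have hyc : Continuous (P.chainFlow N x η) := pinnedChain_continuous_chainFlow hω hl hβ hγ N x hη
  have hsol := pinnedChain_isIntegralSolutionOn_chainFlow hω hl hβ hγ N x hη t
  have hdrift : Continuous (P.drift N) := (pinnedChain_contDiff_drift ω₂ lam β γ N (n := 0)).continuous
  have hz : Literature.Analysis.ODE.IsIntegralSolutionOn (P.drift N) (OscillatorChain.forcing (siteReflection N x)
      (fun s => η s ∘ Fin.rev)) (fun s => siteReflection N (P.chainFlow N x η s)) t := by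
    intro s hs
    have h := hsol s hs
    have hint : IntervalIntegrable (fun r => P.drift N (P.chainFlow N x η r)) volume 0 s :=
      (hdrift.comp hyc).intervalIntegrable 0 s
    show siteReflection N (P.chainFlow N x η s) = _
    rw [h, siteReflection_add]
    have h2 : siteReflection N (∫ r in (0 : ℝ)..s, P.drift N (P.chainFlow N x η r)) =
        ∫ r in (0 : ℝ)..s, P.drift N (siteReflection N (P.chainFlow N x η r)) := by
      rw [hA, ← A.intervalIntegral_comp_comm hint]
      refine intervalIntegral.integral_congr fun r _ => ?_
      rw [← hA, drift_siteReflection]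
    rw [h2]
    congr 1
  have hzc : Continuous fun s => siteReflection N (P.chainFlow N x η s) := continuous_siteReflection.comp hyc
  have heq := pinnedChain_eqOn_chainFlow hω hl hβ hγ N (siteReflection N x) hη' hz hzc (show t ∈ Icc 0 t from ⟨ht.le, le_rfl⟩)
  exact heq.symm

/-- **The solution map is reflection equivariant under the swap of the driving pair** (equal bath
temperatures, so equal noise amplitudes). [folklore] -/
theorem solMap_siteReflection (N : ℕ) (T t : ℝ) (x : PhaseSpace N) (w : WienerPair) :
    (pinnedChain ω₂ lam β γ).solMap N T T t (siteReflection N x) (w.2, w.1) =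
      siteReflection N ((pinnedChain ω₂ lam β γ).solMap N T T t x w) := by
  unfold OscillatorChain.solMap
  rw [chainNoise_swap]
  exact chainFlow_siteReflection hω hl hβ hγ N x (continuous_chainNoise _ _ w) t

/-- **Reflection covariance of the equilibrium transition kernels**: `P_t(Rx, ·) = R_* P_t(x, ·)` at
equal bath temperatures (swap invariance of the product Wiener measure). [folklore] -/
theorem transitionKernel_siteReflection (N : ℕ) (T : ℝ) (t : ℝ≥0) (x : PhaseSpace N) :
    (pinnedChain ω₂ lam β γ).transitionKernel N T T t (siteReflection N x) =
      ((pinnedChain ω₂ lam β γ).transitionKernel N T T t x).map (siteReflection N) := by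
  rw [pinnedChain_transitionKernel_apply hω hl hβ hγ N T T t (siteReflection N x),
    pinnedChain_transitionKernel_apply hω hl hβ hγ N T T t x]
  have hg := pinnedChain_measurable_solMap_pairPath_right hω hl hβ hγ N T T t x
  have hg' := pinnedChain_measurable_solMap_pairPath_right hω hl hβ hγ N T T t (siteReflection N x)
  rw [Measure.map_map measurable_siteReflection hg]
  haveI := Literature.Probability.RandomPlanarGeometry.isProbabilityMeasure_preWienerMeasure'
  have hswap : (wienerPair : Measure WienerPair).map Prod.swap = wienerPair := Measure.prod_swap
  conv_lhs => rw [← hswap]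
  rw [Measure.map_map hg' measurable_swap]
  congr 1
  funext ω
  simp only [Function.comp_apply]
  have hp : pairPath (Prod.swap ω) = ((pairPath ω).2, (pairPath ω).1) := rfl
  rw [hp, solMap_siteReflection hω hl hβ hγ]

/-- **The total current's kernel average is odd under the reflection**: `P_t J (Rx) = -P_t J (x)`. [folklore] -/
theorem kernelAverage_sum_bondCurrent_siteReflection (N : ℕ) (T : ℝ) (t : ℝ≥0) (x : PhaseSpace N) :
    ∫ y, (∑ i : Fin N, (pinnedChain ω₂ lam β γ).bondCurrent N i y)
        ∂((pinnedChain ω₂ lam β γ).transitionKernel N T T t (siteReflection N x)) =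
      -∫ y, (∑ i : Fin N, (pinnedChain ω₂ lam β γ).bondCurrent N i y)
        ∂((pinnedChain ω₂ lam β γ).transitionKernel N T T t x) := by
  rw [transitionKernel_siteReflection hω hl hβ hγ]
  have hJ : Continuous fun y : PhaseSpace N => ∑ i : Fin N, (pinnedChain ω₂ lam β γ).bondCurrent N i y :=
    continuous_finsetSum _ fun i _ => pinnedChain_continuous_bondCurrent ω₂ lam β γ N i
  rw [integral_map measurable_siteReflection.aemeasurable hJ.aestronglyMeasurable, ← integral_neg]
  refine integral_congr_ae (Eventually.of_forall fun y => ?_)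
  exact (pinnedChain ω₂ lam β γ).sum_bondCurrent_siteReflection (pinnedChain_V_neg ω₂ lam β γ) N y

end Flow

/-! ## The reflection preserves Lebesgue measure and the Gibbs weight -/

/-- Reversing the coordinates preserves Lebesgue measure on `Fin N → ℝ`. [folklore] -/
theorem measurePreserving_comp_rev :
    MeasurePreserving (fun q : Fin N → ℝ => q ∘ Fin.rev) volume volume := by
  have h := volume_measurePreserving_piCongrLeft (fun _ : Fin N => ℝ) Fin.revPerm
  have heq : (⇑(MeasurableEquiv.piCongrLeft (fun _ : Fin N => ℝ) Fin.revPerm) : (Fin N → ℝ) → Fin N → ℝ) =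
      fun q => q ∘ Fin.rev := by
    funext q j
    have := MeasurableEquiv.piCongrLeft_apply_apply (β := fun _ : Fin N => ℝ) Fin.revPerm q (Fin.rev j)
    simpa using this
  rwa [heq] at h

/-- The site reflection preserves Lebesgue measure on phase space. [folklore] -/
theorem measurePreserving_siteReflection_volume :
    MeasurePreserving (siteReflection N) (volume : Measure (PhaseSpace N)) volume := by
  have h := (measurePreserving_comp_rev (N := N)).prod (measurePreserving_comp_rev (N := N))
  exact h

variable {ω₂ lam β : ℝ}

/-- The site reflection preserves the Gibbs weight (`H ∘ R = H`). [folklore] -/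
theorem measurePreserving_siteReflection_gibbsWeight (γ : ℝ) (N : ℕ) (T : ℝ) :
    MeasurePreserving (siteReflection N) (gibbsWeight ω₂ lam β γ N T) (gibbsWeight ω₂ lam β γ N T) := by
  refine ⟨measurable_siteReflection, ?_⟩
  unfold gibbsWeight
  set ρ := fun x : PhaseSpace N => ENNReal.ofReal (Real.exp (-((pinnedChain ω₂ lam β γ).hamiltonian N x) / T))
  have hρ : Measurable ρ := measurable_gibbsDensity_ofReal γ N T
  have hρR : ∀ x, ρ (siteReflection N x) = ρ x := by
    intro x
    simp only [ρ]
    rw [(pinnedChain ω₂ lam β γ).hamiltonian_siteReflection (pinnedChain_V_neg ω₂ lam β γ)]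
  ext s hs
  rw [Measure.map_apply measurable_siteReflection hs, withDensity_apply _ hs,
    withDensity_apply _ (measurable_siteReflection hs)]
  rw [← (measurePreserving_siteReflection_volume (N := N)).setLIntegral_comp_preimage hs hρ]
  exact setLIntegral_congr_fun (measurable_siteReflection hs) fun x _ => (hρR x).symm

/-- Lebesgue measure is absolutely continuous with respect to the Gibbs weight (positive density).
[folklore] -/
theorem volume_absolutelyContinuous_gibbsWeight (γ : ℝ) (N : ℕ) (T : ℝ) :
    (volume : Measure (PhaseSpace N)) ≪ gibbsWeight ω₂ lam β γ N T := by
  unfold gibbsWeight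
  refine withDensity_absolutelyContinuous' (measurable_gibbsDensity_ofReal γ N T).aemeasurable
    (Eventually.of_forall fun x => ?_)
  exact (ENNReal.ofReal_pos.2 (Real.exp_pos _)).ne'

/-! ## Oddness of the corrector under the reflection, and the two tap norms -/

section Corrector

variable (hω : 0 < ω₂) (hl : 0 ≤ lam) (hβ : 0 ≤ β) {γ : ℝ} (hγ : 0 ≤ γ) (N : ℕ) {T : ℝ}
include hω hl hβ hγ

/-- **A continuous a.e.-limit of the finite-horizon correctors is odd under the reflection,
everywhere.** [folklore] -/
theorem corrector_siteReflection {u : PhaseSpace N → ℝ} (hu : Continuous u)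
    (h3 : ∀ᵐ x ∂(gibbsWeight ω₂ lam β γ N T), Tendsto (fun τ : ℝ => ∫ t in Ioc (0 : ℝ) τ,
      ∫ y, (∑ i : Fin N, (pinnedChain ω₂ lam β γ).bondCurrent N i y)
        ∂((pinnedChain ω₂ lam β γ).transitionKernel N T T t.toNNReal x)) atTop (𝓝 (u x))) (x : PhaseSpace N) :
    u (siteReflection N x) = -u x := by
  set P := pinnedChain ω₂ lam β γ
  set μ := gibbsWeight ω₂ lam β γ N T
  set U : ℝ → PhaseSpace N → ℝ := fun τ x => ∫ t in Ioc (0 : ℝ) τ,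
    ∫ y, (∑ i : Fin N, P.bondCurrent N i y) ∂(P.transitionKernel N T T t.toNNReal x) with hU
  have hUodd : ∀ τ x, U τ (siteReflection N x) = -U τ x := by
    intro τ x
    simp only [hU]
    rw [← integral_neg]
    refine setIntegral_congr_fun measurableSet_Ioc fun t _ => ?_
    exact kernelAverage_sum_bondCurrent_siteReflection hω hl hβ hγ N T t.toNNReal x
  have hmp := measurePreserving_siteReflection_gibbsWeight (ω₂ := ω₂) (lam := lam) (β := β) γ N T
  have h3' : ∀ᵐ x ∂μ, Tendsto (fun τ : ℝ => U τ (siteReflection N x)) atTop (𝓝 (u (siteReflection N x))) :=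
    hmp.quasiMeasurePreserving.ae h3
  have hae : ∀ᵐ x ∂μ, u (siteReflection N x) + u x = 0 := by
    filter_upwards [h3, h3'] with x hx hx'
    have h1 : Tendsto (fun τ : ℝ => U τ (siteReflection N x)) atTop (𝓝 (-u x)) := by
      simp only [hUodd]
      exact hx.neg
    have := tendsto_nhds_unique hx' h1
    linarith
  -- a continuous function vanishing a.e. for the Gibbs weight vanishes everywhere
  have hae' : (fun x => u (siteReflection N x) + u x) =ᵐ[(volume : Measure (PhaseSpace N))] fun _ => 0 :=
    (volume_absolutelyContinuous_gibbsWeight (ω₂ := ω₂) (lam := lam) (β := β) γ N T).ae_le hae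
  have hcont : Continuous fun x => u (siteReflection N x) + u x := (hu.comp continuous_siteReflection).add hu
  have heq := Measure.eq_of_ae_eq hae' hcont continuous_const
  have := congrFun heq x
  linarith

omit hω hl hβ hγ in
/-- For a function odd under the reflection, the left tap derivative is minus the reflected right
tap derivative: `∂_{p_0}u (x) = -(∂_{p_{N-1}}u)(Rx)`. [folklore] -/
theorem partialP_tap_of_odd {u : PhaseSpace N → ℝ} (hodd : ∀ x, u (siteReflection N x) = -u x)
    (b₀ b₁ : Fin N) (hb : b₁ = Fin.rev b₀) (x : PhaseSpace N) :
    partialP b₀ u x = -partialP b₁ u (siteReflection N x) := by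
  have hu : u = fun y => -(u ∘ siteReflection N) y := funext fun y => by simp [hodd y]
  conv_lhs => rw [hu]
  unfold partialP
  simp only [Function.comp_apply, deriv.fun_neg]
  have h := partialP_comp_siteReflection b₀ u x
  unfold partialP at h
  simp only [Function.comp_apply] at h
  rw [h, hb]

omit hω hl hβ hγ in
/-- **The two tap norms of a reflection-odd function agree**, as Bochner integrals (junk values
included) … [folklore] -/
theorem integral_partialP_sq_tap_eq {u : PhaseSpace N → ℝ} (hodd : ∀ x, u (siteReflection N x) = -u x)
    (b₀ b₁ : Fin N) (hb : b₁ = Fin.rev b₀) :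
    ∫ x, (partialP b₀ u x) ^ 2 ∂(gibbsWeight ω₂ lam β γ N T) = ∫ x, (partialP b₁ u x) ^ 2 ∂(gibbsWeight ω₂ lam β γ N T) := by
  have hmp := measurePreserving_siteReflection_gibbsWeight (ω₂ := ω₂) (lam := lam) (β := β) γ N T
  have h : (fun x => (partialP b₀ u x) ^ 2) = fun x => (partialP b₁ u (siteReflection N x)) ^ 2 := by
    funext x; rw [partialP_tap_of_odd N hodd b₀ b₁ hb x, neg_sq]
  rw [h]
  exact hmp.integral_comp (siteReflectionEquiv N).measurableEmbedding (fun x => (partialP b₁ u x) ^ 2)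

omit hω hl hβ hγ in
/-- … and one is integrable iff the other is. [folklore] -/
theorem integrable_partialP_sq_tap_iff {u : PhaseSpace N → ℝ} (hodd : ∀ x, u (siteReflection N x) = -u x)
    (b₀ b₁ : Fin N) (hb : b₁ = Fin.rev b₀) :
    Integrable (fun x => (partialP b₀ u x) ^ 2) (gibbsWeight ω₂ lam β γ N T) ↔
      Integrable (fun x => (partialP b₁ u x) ^ 2) (gibbsWeight ω₂ lam β γ N T) := by
  have hmp := measurePreserving_siteReflection_gibbsWeight (ω₂ := ω₂) (lam := lam) (β := β) γ N T
  have h : (fun x => (partialP b₀ u x) ^ 2) = (fun x => (partialP b₁ u x) ^ 2) ∘ siteReflection N := by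
    funext x; simp only [Function.comp_apply]; rw [partialP_tap_of_odd N hodd b₀ b₁ hb x, neg_sq]
  rw [h]
  exact hmp.integrable_comp_emb (siteReflectionEquiv N).measurableEmbedding

end Corrector

end Summit.AtomisticToContinuum.FouriersLaw.Theorems.OddSectorWitness
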